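import Summits.Ventures.LatticeQCDFlow.Scaling.HomStarExchangeableLaw
import Summits.Ventures.LatticeQCDFlow.Scaling.LumpedStarClockDecay

/-!
HONEST FRAMING: exact (Metropolis-corrected) sampling algorithms for lattice gauge theory; figures
of merit are autocorrelation/cost numbers at stated couplings and volumes; no continuum-physics
claim.

# HomStarSharpLaw — THE SCHEME-LEVEL SHARP LAW: FOR CHAPTER U's HOMOGENEOUS REPLICA-EXCHANGE STAR AT EVERY SWAP RATE, THE LAW OF (HUB CONTENT, COMPOSITION) — EVERY POOLED
# OBSERVABLE — IS WITHIN `(2D/r)·(1 − (t+h)(1 − (1+(1−σ)r/48)⁻¹))ⁿ` OF `π_S` AFTER `n` SCHEME STEPS, `σ = t/(t+h)`, `h = (1−t)w_0`, `r = σp̄/(c+2K+2)` — ORDER `(K/(p̄·min{t,h}))·log(K/(p̄ε))`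
# (lean-2 GEN-44, ours)

Venture-side (OURS).  Cell `lqcd-flow` (pub-lqcd), unit `pub-lqcd-lean-2-g44`, 2026-08-31.  Chapter AD, file 10 = file 3 (the sharp step law of X5's chain, from the tagged data of every
oriented adjacent pair) composed with file 9 (the transfer through the lumping `Λ`), stated once for the scheme of chapter U (`t·ptGraphSwap μ {(0,(κ r).succ)} id + (1−t)·prodKernel w M`,
exact hot redraws, idle cold levels of one law `μ_1`, uniform entry list with `c'` entries per level), with X5's objects on the lumped state space (`hub`, `comp`, `hinj/hsurj/hhub/hsum`),
`W = μ_1/μ_0`, `θ = 1/(1+pW)`, `acc(h,v) = min{1, W_h/W_v}`, the swap odds `σ = t/(t + (1−t)w_0)` of the step chain, and a lumping map `Λ` (`hub ∘ Λ = (·) 0`, `comp ∘ Λ` = the counts).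

* **`homStar_sharp_tvDist_le`**.

Reading (no numerics implied): the pooled cold samples of `K` identical replicas behind one persistent hot sampler equilibrate in `O((K/(p̄·min{t,(1−t)w_0}))·log(K/(p̄ε)))` scheme steps for
EVERY swap fraction `t` — `p̄ = pE_{μ_0}[Wθ] ≥ p/2`; chapter U's slow-swap law (`4t ≤ h`) and chapter V's urn (`t → 1` in cycles) are the two ends.  NOT CLAIMED: the labelled chain's own
mixing; constants.  Literature grade (cell rule): OWN; nothing cited; no new bib keys.
-/

noncomputable section
open Finset Function
open Literature.Probability.MarkovChains

namespace Summit.Ventures.LatticeQCDFlow.Scaling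

section SharpLaw
variable {S : Type*} [Fintype S] [DecidableEq S] {K m : ℕ} {μ : Fin (K + 1) → S → ℝ} {M : Fin (K + 1) → S → S → ℝ} {w : Fin (K + 1) → ℝ} {t : ℝ}
variable (κ : Fin m → Fin K)
variable {X : Type*} [Fintype X] [DecidableEq X]
variable {hub : X → S} {comp : X → S → ℕ} {W θ : S → ℝ} {p σ c C : ℝ} {acc : S → S → ℝ} {Kh : (S → ℕ) → S → S → ℝ}
variable {Δ : (S → ℕ) → (S → ℕ) → ℕ} {F Ψ : X × X → ℝ}
variable {NCf : X → X → S → ℕ} {af bf : X → X → S} {PXf PYf : X → X → Option S → Option S → ℝ} {xtf ytf xsf ysf : X → X → Option S → ℝ}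
variable {Ast Bst Sst : X → X → ℝ} {g : (S → ℕ) → ℝ} {πS : X → ℝ} {Z : ℝ}
variable {Λ : (Fin (K + 1) → S) → X}

/-- **THE SCHEME-LEVEL SHARP LAW FOR THE HOMOGENEOUS REPLICA-EXCHANGE STAR** (see the module docstring). [ours] -/
theorem homStar_sharp_tvDist_le [Nonempty X] (hm : 1 ≤ m) (hμ : ∀ k x, 0 < μ k x) (hμsum : ∀ k, ∑ u, μ k u = 1) (hhom : ∀ i : Fin K, μ i.succ = μ 1)
    (hw0 : ∀ k, 0 ≤ w k) (hw00 : 0 < w 0) (hw1 : ∑ k, w k = 1) (ht0 : 0 < t) (ht1 : t < 1)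
    (hM0 : ∀ u v, M 0 u v = μ 0 v) (hidle : ∀ i : Fin K, ∀ u v, M i.succ u v = if v = u then 1 else 0)
    {c' : ℕ} (hunif : ∀ i : Fin K, (univ.filter fun r : Fin m => κ r = i).card = c')
    (hWdef : ∀ v, W v = μ 1 v / μ 0 v) (hinj : ∀ x x', hub x = hub x' → comp x = comp x' → x = x') (hsum : ∀ x, ∑ v, comp x v = K + 1)
    (hsurj : ∀ (z : S) (N : S → ℕ), ∑ v, N v = K + 1 → N z ≠ 0 → ∃ x, hub x = z ∧ comp x = N) (hhub : ∀ x, comp x (hub x) ≠ 0) (hK : 2 ≤ K)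
    (hW : ∀ v, 0 < W v) (hp0 : 0 ≤ p) (hp : ∀ v, p * W v ≤ 1) (hθ : ∀ v, θ v = 1 / (1 + p * W v)) (hacc : ∀ h v, acc h v = min 1 (W h / W v))
    (hc : 2 * (K : ℝ) + 4 ≤ c) (hσ : σ = t / (t + (1 - t) * w 0))
    (hgap : 0 < p * ∑ v, μ 0 v * (W v * θ v))
    (hKoff : ∀ N h v, h ≠ v → Kh N h v = if N h = 0 then 0 else (N v : ℝ) / K * acc h v) (hKdiag : ∀ N h, Kh N h h = 1 - ∑ v ∈ univ.erase h, Kh N h v)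
    (hΔ : ∀ N N', Δ N N' = ∑ v, (N v - N' v))
    (hF : ∀ x y, F (x, y) = c + (-(1 - σ) * θ (hub x)) + (-(1 - σ) * θ (hub y)) + ∑ v, θ v * ((comp x v : ℝ) + (comp y v : ℝ)))
    (hC : C = 2 * ((K + 1) * (c + 2 * K + 6)))
    (hΨ : ∀ x y, Ψ (x, y) = (Δ (comp x) (comp y) : ℝ) * F (x, y) + C * (if hub x = hub y then (0 : ℝ) else 1))
    -- the tagged data of every ORIENTED adjacent pair (as in W23 ∕ X6)
    (horient : ∀ x y, hub x = hub y → Δ (comp x) (comp y) = 1 → W (bf x y) ≤ W (af x y) ∨ W (bf y x) ≤ W (af y x))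
    (hcx : ∀ x y, hub x = hub y → Δ (comp x) (comp y) = 1 → W (bf x y) ≤ W (af x y) → comp x = NCf x y + Pi.single (af x y) 1)
    (hcy : ∀ x y, hub x = hub y → Δ (comp x) (comp y) = 1 → W (bf x y) ≤ W (af x y) → comp y = NCf x y + Pi.single (bf x y) 1)
    (hPXoff : ∀ x y, hub x = hub y → Δ (comp x) (comp y) = 1 → W (bf x y) ≤ W (af x y) →
      ∀ h v, h ≠ v → PXf x y (some h) (some v) = if NCf x y h = 0 then 0 else (NCf x y v : ℝ) / K * acc h v)
    (hPXin : ∀ x y, hub x = hub y → Δ (comp x) (comp y) = 1 → W (bf x y) ≤ W (af x y) →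
      ∀ h, PXf x y (some h) none = if NCf x y h = 0 then 0 else acc h (af x y) / K)
    (hPXdiag : ∀ x y, hub x = hub y → Δ (comp x) (comp y) = 1 → W (bf x y) ≤ W (af x y) →
      ∀ h, PXf x y (some h) (some h) = 1 - (∑ v ∈ univ.erase h, PXf x y (some h) (some v) + PXf x y (some h) none))
    (hPXout : ∀ x y, hub x = hub y → Δ (comp x) (comp y) = 1 → W (bf x y) ≤ W (af x y) → ∀ v, PXf x y none (some v) = (NCf x y v : ℝ) / K * acc (af x y) v)
    (hPXstay : ∀ x y, hub x = hub y → Δ (comp x) (comp y) = 1 → W (bf x y) ≤ W (af x y) → PXf x y none none = 1 - ∑ v, PXf x y none (some v))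
    (hPYoff : ∀ x y, hub x = hub y → Δ (comp x) (comp y) = 1 → W (bf x y) ≤ W (af x y) →
      ∀ h v, h ≠ v → PYf x y (some h) (some v) = if NCf x y h = 0 then 0 else (NCf x y v : ℝ) / K * acc h v)
    (hPYin : ∀ x y, hub x = hub y → Δ (comp x) (comp y) = 1 → W (bf x y) ≤ W (af x y) →
      ∀ h, PYf x y (some h) none = if NCf x y h = 0 then 0 else acc h (bf x y) / K)
    (hPYdiag : ∀ x y, hub x = hub y → Δ (comp x) (comp y) = 1 → W (bf x y) ≤ W (af x y) →
      ∀ h, PYf x y (some h) (some h) = 1 - (∑ v ∈ univ.erase h, PYf x y (some h) (some v) + PYf x y (some h) none))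
    (hPYout : ∀ x y, hub x = hub y → Δ (comp x) (comp y) = 1 → W (bf x y) ≤ W (af x y) → ∀ v, PYf x y none (some v) = (NCf x y v : ℝ) / K * acc (bf x y) v)
    (hPYstay : ∀ x y, hub x = hub y → Δ (comp x) (comp y) = 1 → W (bf x y) ≤ W (af x y) → PYf x y none none = 1 - ∑ v, PYf x y none (some v))
    (hxtf : ∀ x y, hub x = hub y → Δ (comp x) (comp y) = 1 → W (bf x y) ≤ W (af x y) →
      ∀ t, xtf x y t = (1 - σ) * PXf x y (some (hub x)) t + σ * ∑ t', xtf x y t' * PXf x y t' t)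
    (hytf : ∀ x y, hub x = hub y → Δ (comp x) (comp y) = 1 → W (bf x y) ≤ W (af x y) →
      ∀ t, ytf x y t = (1 - σ) * PYf x y (some (hub x)) t + σ * ∑ t', ytf x y t' * PYf x y t' t)
    (hxsf : ∀ x y, hub x = hub y → Δ (comp x) (comp y) = 1 → W (bf x y) ≤ W (af x y) →
      ∀ t, xsf x y t = (1 - σ) * PXf x y none t + σ * ∑ t', xsf x y t' * PXf x y t' t)
    (hysf : ∀ x y, hub x = hub y → Δ (comp x) (comp y) = 1 → W (bf x y) ≤ W (af x y) →
      ∀ t, ysf x y t = (1 - σ) * PYf x y none t + σ * ∑ t', ysf x y t' * PYf x y t' t)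
    -- the step chain of the lumped star (file X5 `LumpedStarStepChain`)
    (hA : ∀ x x', Ast x x' = if comp x' = comp x then Kh (comp x) (hub x) (hub x') else 0)
    (hB : ∀ x x', Bst x x' = μ 0 (hub x') * (if comp x' + Pi.single (hub x) 1 = comp x + Pi.single (hub x') 1 then 1 else 0))
    (hS : ∀ x x', Sst x x' = σ * Ast x x' + (1 - σ) * Bst x x')
    (hg : ∀ N, g N = ∏ v, (μ 0 v * W v) ^ (N v) / ((N v).factorial : ℝ))
    (hZ : Z = ∑ x, g (comp x) * ((comp x (hub x) : ℝ) / W (hub x))) (hπS : ∀ x, πS x = g (comp x) * ((comp x (hub x) : ℝ) / W (hub x)) / Z)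
    (hΛh : ∀ y, hub (Λ y) = y 0) (hΛc : ∀ y v, comp (Λ y) v = (univ.filter fun k : Fin (K + 1) => y k = v).card)
    (y : Fin (K + 1) → S) (n : ℕ) :
    tvDist (fun x' => ∑ z ∈ univ.filter (fun z => Λ z = x'),
        lawAt (fun a b => t * ptGraphSwap μ (fun r : Fin m => (((0 : Fin (K + 1)), (κ r).succ) : Fin (K + 1) × Fin (K + 1))) (fun _ : Fin m => Equiv.refl S) a b
          + (1 - t) * prodKernel w M a b) (Pi.single y 1) n z) πS
      ≤ 2 * (((K : ℝ) + 1) * (c + 2 * K + 2) + C) / (σ * (p * ∑ v, μ 0 v * (W v * θ v)) / (c + 2 * K + 2))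
        * (1 - (t + (1 - t) * w 0) * (1 - (1 + (1 - σ) * (σ * (p * ∑ v, μ 0 v * (W v * θ v)) / (c + 2 * K + 2)) / 48)⁻¹)) ^ n := by
  classical
  have hh : 0 < (1 - t) * w 0 := mul_pos (by linarith) hw00
  have hq : 0 < t + (1 - t) * w 0 := by linarith
  have hσ0 : 0 < σ := by rw [hσ]; exact div_pos ht0 hq
  have hσ1 : σ < 1 := by rw [hσ, div_lt_one hq]; linarith
  -- the acceptance in chapter U's form
  have hacc' : ∀ u v, acc u v = min 1 (μ 0 v * μ 1 u / (μ 0 u * μ 1 v)) := by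
    intro u v
    rw [hacc, hWdef, hWdef]
    congr 1
    have h1 := hμ 0 u; have h2 := hμ 0 v; have h3 := hμ 1 u; have h4 := hμ 1 v
    field_simp
  -- the step chain in file 9's form
  have hS' : ∀ x x', Sst x x' = t / (t + (1 - t) * w 0) * Ast x x' + (1 - t / (t + (1 - t) * w 0)) * Bst x x' := fun x x' => by rw [hS, hσ]
  -- the decay of file 3 and its transfer (file 9)
  have hβ0 : 0 ≤ (1 + (1 - σ) * (σ * (p * ∑ v, μ 0 v * (W v * θ v)) / (c + 2 * K + 2)) / 48)⁻¹ := by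
    have hK0 : (0 : ℝ) ≤ K := Nat.cast_nonneg _
    have : 0 ≤ (1 - σ) * (σ * (p * ∑ v, μ 0 v * (W v * θ v)) / (c + 2 * K + 2)) / 48 :=
      div_nonneg (mul_nonneg (by linarith) (div_nonneg (mul_nonneg hσ0.le hgap.le) (by linarith))) (by norm_num)
    exact inv_nonneg.mpr (by linarith)
  have hdec := lumpedStar_clock_worstTvDist_le hinj hsum hsurj hhub hK hW hp0 hp hθ hacc (fun v => (hμ 0 v).le) (hμsum 0) (hμ 0) hc hσ0 hσ1 hgap hKoff hKdiag hΔ hF hC hΨ horient hcx hcy hPXoff hPXin hPXdiag hPXout hPXstay hPYoff hPYin hPYdiag hPYout hPYstay hxtf hytf hxsf hysf hA hB hS hg hZ hπS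
  exact homStar_exchangeable_tvDist_le κ hm hμ hhom hw0 hw1 ht1.le hM0 hidle hunif hacc' hKoff hKdiag hA hB hS' hq hΛh hΛc hinj hβ0 hdec y n

end SharpLaw

end Summit.Ventures.LatticeQCDFlow.Scaling

end
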